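import Summits.NavierStokesRegularity.NavierStokesRegularity.Theses.SymmetryModuliCount
import Summits.NavierStokesRegularity.NavierStokesRegularity.Theorems.SymmetryModuliCountAxisymEndLiouvilleStubAxisNormalForm
import Summits.NavierStokesRegularity.NavierStokesRegularity.Theorems.SymmetryModuliCountAxisymEndLiouvilleStubWeightProfile
import Summits.NavierStokesRegularity.NavierStokesRegularity.Theorems.SymmetryModuliCountAxisymEndLiouvilleStubSwirlComparison
import Summits.NavierStokesRegularity.NavierStokesRegularity.Theorems.SymmetryModuliCountAxisymEndLiouvilleStubNoSwirlLiouville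

/-!
# `AxisymEndLiouville` (stmt-NavierStokesRegularity-14061, route SymmetryModuliCount) — PROVED

Line `absorbing-axis-swirl-extinction` (crux protocol).  The crux: an element `u` of the Type-I
ancient mild class `𝒜_C` (`IsTypeIAncientMild C u`: smooth on `t < 0`, divergence free,
KNSS/Oseen-mild between all pairs of negative times, `‖u(t,x)‖ ≤ C/√(−t)`) annihilated on a
backward end `t < θ ≤ 0` by the rotation field `x ↦ A (x − c)` of a nonzero skew `A`
(`Du·A(x−c) − Au = 0`, i.e. axisymmetric with swirl about the axis `c + ker A`) vanishes on
that end.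

Assembly of the landed stubs:
1. `stub_axisNormalForm` — rigid-motion + time-shift covariance of `𝒜_C`: WLOG the axis is the
   vertical axis through `0`, the symmetry is integrated (`IsAxisymmetric (v t)`) and holds for
   all `t < 0`;
2. `stub_swirlWeightProfile` — an explicit weight `W` (`C²` on `(0,∞)`, continuous on `[0,∞)`,
   `W, W' ≥ 0`, `ρ ≤ K W(ρ)`) with `W'' − (ρ/2 + 1/ρ − C) W' + λ W ≤ 0`, `λ > 0`;
3. `stub_swirlComparison` — the weighted maximum principle
   `|Γ(t,x)| ≤ C K (t/t')^λ W(r/√(−t))` for all `t' < t < 0` (comparison with the supersolution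
   `C K (t/t')^λ W(r/√(−t))` of the swirl equation KNSS (1.8));
4. `t' → −∞` kills the swirl (`(t/t')^λ → 0`): the Type-I ancient field is swirl free;
5. `stub_noSwirlLiouville` — KNSS 2009 Thm 5.2 (tree `knss_axisymmetric_no_swirl_holds`) on the
   bounded time shifts plus the gauge (`eq_zero_of_slice_const`) give `v ≡ 0`, hence `u ≡ 0` on
   the end.
-/

noncomputable section

-- the summit and its single problem share the name `NavierStokesRegularity` (D-0017 nested layout)
set_option linter.dupNamespace false

open Set Function Filter Topology MeasureTheory InnerProductSpace Metric
open scoped RealInnerProductSpace Laplacian ContDiff NNReal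

namespace Summit.NavierStokesRegularity.NavierStokesRegularity.Theorems

open Literature.Analysis.FluidPDE
open Summit.NavierStokesRegularity.NavierStokesRegularity.Theorems.AxisymEndLiouville.AbsorbingAxisSwirlExtinction

/-! ## Glue -/

/-- For `λ > 0`, `t < 0` and any `a`: `a (t/t')^λ ≤ η` for some `t' < t` far in the past (`(t/t')^λ → 0`). -/
theorem exists_past_rpow_mul_le (a : ℝ) {lam t η : ℝ} (hlam : 0 < lam) (ht : t < 0)
    (hη : 0 < η) : ∃ t' : ℝ, t' < t ∧ a * (t / t') ^ lam ≤ η := by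
  -- `T ↦ a * ((-t) * T⁻¹) ^ lam → 0` as `T → ∞`
  have h1 : Tendsto (fun T : ℝ => T ^ (-lam)) atTop (𝓝 0) := tendsto_rpow_neg_atTop hlam
  have h2 : Tendsto (fun T : ℝ => a * (-t) ^ lam * T ^ (-lam)) atTop (𝓝 0) := by
    simpa using h1.const_mul (a * (-t) ^ lam)
  have h3 : ∀ᶠ T in atTop, a * (-t) ^ lam * T ^ (-lam) ≤ η :=
    (h2.eventually (ge_mem_nhds hη))
  obtain ⟨T, hT⟩ := (h3.and (eventually_gt_atTop (max (-t) 0))).exists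
  obtain ⟨hTη, hTgt⟩ := hT
  have hT0 : 0 < T := lt_of_le_of_lt (le_max_right _ _) hTgt
  have hTt : -t < T := lt_of_le_of_lt (le_max_left _ _) hTgt
  refine ⟨-T, by linarith, ?_⟩
  have e : (t / -T) = (-t) * T⁻¹ := by field_simp
  rw [e, Real.mul_rpow (by linarith) (inv_nonneg.2 hT0.le), Real.inv_rpow hT0.le,
    ← Real.rpow_neg hT0.le, ← mul_assoc]
  exact hTη

/-- **The crux `AxisymEndLiouville`** (stmt-NavierStokesRegularity-14061): a Type-I ancient mild
field annihilated on a backward end by the rotations about an axis vanishes on that end. -/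
theorem AxisymEndLiouville_of :
    Summit.NavierStokesRegularity.NavierStokesRegularity.Theses.SymmetryModuliCount.AxisymEndLiouville := by
  intro C u hu c A θ hskew hA hθ hsym
  obtain ⟨v, hv, hvaxi, hback⟩ := stub_axisNormalForm C u hu c A θ hskew hA hθ hsym
  apply hback
  have hC : 0 ≤ C := hv.nonneg
  obtain ⟨lam, K, hlam, hK, W, hWc, hW2, hW0, hWK, hW1, hWineq⟩ := stub_swirlWeightProfile C hC
  -- the swirl of `v` vanishes: `|Γ(t,y)| ≤ C K (t/t')^λ W(ρ)` for every `t' < t`, and `t' → -∞`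
  have hsw : ∀ t < 0, HasNoSwirl (v t) := by
    intro t ht y
    refine abs_nonpos_iff.1 (le_of_forall_pos_le_add fun η hη => ?_)
    obtain ⟨t', ht', hle⟩ := exists_past_rpow_mul_le (C * K * W (cylRadius y / Real.sqrt (-t))) hlam ht hη
    have key := stub_swirlComparison C lam K W hlam hK hWc hW2 hW0 hWK hW1 hWineq v hv hvaxi
      t' t ht' ht y
    calc |swirl (v t) y| ≤ C * K * (t / t') ^ lam * W (cylRadius y / Real.sqrt (-t)) := key
      _ = C * K * W (cylRadius y / Real.sqrt (-t)) * (t / t') ^ lam := by ring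
      _ ≤ η := hle
      _ ≤ 0 + η := by rw [zero_add]
  exact stub_noSwirlLiouville C v hv hvaxi hsw

end Summit.NavierStokesRegularity.NavierStokesRegularity.Theorems

end
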